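import Literature.NumberTheory.Transcendental.ZilberPrimeModelIso
import Literature.NumberTheory.Transcendental.GammaIsoCrossTransfer
import HarnessLib

/-!
# Countable Zilber fields of infinite dimension are isomorphic

J. Kirby, *Finitely presented exponential fields*, Algebra & Number Theory 7 (2013) 943–980,
Cor. 6.10 (the countable models of `ECF_{SK,CCP}` are classified by their exponential
transcendence degree); as used in M. Bays, J. Kirby, *Excellence and uncountable categoricity of
Zilber's exponential fields*, arXiv:1305.0493, §2.1 ("In particular there is a unique countable
model `B_{ℵ₀}` of exponential transcendence degree `ℵ₀`") and §2.4 ("The axioms of quasiminimal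
excellent classes we use refer only to the countable models of `ECF_{SK,CCP}` and these all embed
in `B`, so it is enough to consider all our structures to be substructures of `B`"); B. Zilber,
Ann. Pure Appl. Logic 132 (2005), Lemma 5.11 / Thm 5.13 (uniqueness of the countable
existentially closed structure). We prove the case needed for Zilber's categoricity theorem:
**two countable Zilber fields (`IsZilberField`, same universe) of infinite `ecl`-dimension are
isomorphic exponential fields** (`ZilberCountableIso.exists_equiv`).

## Proof

The two-structure back-and-forth of `ZilberPrimeModelIso.lean` (`ZilberPrimeModel.Covered₂`:
cross Γ-isomorphisms `c ↦ c'` over the isomorphism `σ₀ : ℚ^{ab}(τ₁) ≅ ℚ^{ab}(τ₂)` of the base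
Γ-fields, `GammaField.exists_isEBaseIso₂_of_expKernel`, with `ℚτ₁ + ℚc ◁ K`, `ℚτ₂ + ℚc' ◁ K'`),
run between the whole fields (`H₁ = H₂ = ⊤`, countable by hypothesis) instead of the closures of
`∅`. The forth step for a point `d ∈ K` (`forth_top`) has two cases: if `d` is exponentially
algebraic over `c`, it lies in a finitely generated strong extension of predimension `0`, realised
in `K'` by the cross-field `ℵ₀`-saturation over `ℚτ`
(`ZilberSaturationLog.isGammaIsoTw₂_saturation_tau'`, Bays–Kirby 2018 Lemma 8.3) — this is
`ZilberPrimeModel.Covered₂.forth_tau` without the ambient closed sets (`forth_alg`); if `d` is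
exponentially transcendental over `c`, any `d' ∈ K'` exponentially transcendental over `c'`
(which exists because `K'` has infinite dimension) will do, by the uniqueness of the generic type
across two fields (`GammaField.IsGammaIsoTw₂.append_singleton_of_not_mem`, Bays–Kirby 2013
Prop. 5 (i); `ecl(c)` is Γ-closed, Kirby 2010 Thm 1.2). Back: the same with `σ₀⁻¹`. The limit
`K → K'` is a bijection preserving `0, 1, +, ·, exp`, i.e. an isomorphism of exponential fields.
Everything is proved; no named fact is introduced.

## References

* J. Kirby, *Finitely presented exponential fields*, Algebra & Number Theory 7 (2013): Cor. 6.10.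
* M. Bays, J. Kirby, arXiv:1305.0493 (2013): §2.1, §2.4, Prop. 5 (i).
* M. Bays, J. Kirby, Algebra & Number Theory 12 (2018) 493–549: Lemma 8.3, Def. 5.14, Thm 6.9.
* B. Zilber, Ann. Pure Appl. Logic 132 (2005) 67–95: Lemma 5.11, Thm 5.13.
* J. Kirby, *On quasiminimal excellent classes*, J. Symbolic Logic 75 (2010): Thm 2.1 (proof).
-/

noncomputable section

open Set MvPolynomial

universe u

namespace Literature.NumberTheory.Transcendental

namespace ZilberCountableIso

open GammaField ZilberHomogeneity ZilberSaturationMain ZilberSaturationLog ZilberPrimeModel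
  Literature.ModelTheory.ExponentialFields Literature.ModelTheory.ExponentialFields.ExponentialRing
  Literature.ModelTheory.Quasiminimal

variable {K : Type u} [Field K] [CharZero K] [ExponentialRing K]
variable {K' : Type u} [Field K'] [CharZero K'] [ExponentialRing K']

/-! ### Forth, algebraic case: realising an exponentially algebraic point across two fields -/

set_option maxHeartbeats 400000 in
/-- **Forth step over `ℚτ`, algebraic case, across two fields** (Kirby 2010, proof of Thm 2.1;
Bays–Kirby 2018 Lemma 8.3 as the engine): with `K` of kernel `τ₁ℤ`, `K'` algebraically closed
with `exp` onto `K'ˣ` and strongly exponentially-algebraically closed, `σ₀ : ℚ^{ab}(τ₁) ≅ ℚ^{ab}(τ₂)`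
an isomorphism of base Γ-fields and `c ↦ c'` a cross Γ-isomorphism over `σ₀` with
`ℚτ₁ + ℚc ◁ K`, `ℚτ₂ + ℚc' ◁ K'`: a point `d` exponentially algebraic over `ℚτ₁ + ℚc` lies in a
finitely generated strong extension of predimension `0`, which is realised in `K'`
(`ZilberSaturationLog.isGammaIsoTw₂_saturation_tau'`). This is
`ZilberPrimeModel.Covered₂.forth_tau` without ambient closed sets.
[cite: Kirby2010QMEC, Thm 2.1 (proof)] [cite: BaysKirby2018ANT, Lemma 8.3, Def. 5.14] -/
theorem forth_alg [IsAlgClosed K'] (hsurj : IsSurjectiveOntoUnits K')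
    (hSEAC : IsStronglyExpAlgClosed K')
    {τ₁ : K} (hker : expKernel K = AddSubgroup.zmultiples τ₁) (hτ : τ₁ ≠ 0) {τ₂ : K'}
    {σ₀ : fieldOf (Submodule.span ℚ ({τ₁} : Set K)) ≃+* fieldOf (Submodule.span ℚ ({τ₂} : Set K'))}
    (hσ₀ : IsEBaseIso₂ (Submodule.span ℚ ({τ₁} : Set K)) (Submodule.span ℚ ({τ₂} : Set K')) σ₀)
    {m : ℕ} {c : Fin m → K} {c' : Fin m → K'} (hiso : IsGammaIsoTw₂ σ₀ c c')
    (hs : IsStrong (Submodule.span ℚ {τ₁} ⊔ Submodule.span ℚ (range c)))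
    (hs' : IsStrong (Submodule.span ℚ {τ₂} ⊔ Submodule.span ℚ (range c')))
    {d : K} (hdecl : d ∈ ecl (((Submodule.span ℚ {τ₁} ⊔ Submodule.span ℚ (range c) :
      Submodule ℚ K)) : Set K)) :
    ∃ (k : ℕ) (e : Fin (k + 1) → K) (e' : Fin (k + 1) → K'), e 0 = d ∧
      IsGammaIsoTw₂ σ₀ (Fin.append c e) (Fin.append c' e') ∧
      IsStrong (Submodule.span ℚ {τ₁} ⊔ Submodule.span ℚ (range (Fin.append c e))) ∧
      IsStrong (Submodule.span ℚ {τ₂} ⊔ Submodule.span ℚ (range (Fin.append c' e'))) := by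
  classical
  set D : Submodule ℚ K := Submodule.span ℚ {τ₁} ⊔ Submodule.span ℚ (range c) with hDdef
  obtain ⟨n₀, x₀, ⟨i₀, hi₀⟩, hδ₀⟩ := exists_predim_le_zero_of_mem_ecl_coe D hdecl
  -- minimise `δ` over finitely generated extensions of `D + ℚd`
  have hfgd : IsFG D (D ⊔ Submodule.span ℚ {d}) :=
    isFG_sup_left.2 (isFG_span_of_finite D (finite_singleton d))
  obtain ⟨E, hdE, hfgE, -, hmin⟩ := hs.exists_forall_predim_le (fun _ => True) le_sup_left hfgd trivial
  have hDE : D ≤ E := le_sup_left.trans hdE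
  have hdmem : d ∈ E := hdE (Submodule.mem_sup_right (Submodule.mem_span_singleton_self d))
  have hEstrong : IsStrong E :=
    isStrong_of_forall_predim_le hDE hfgE fun X hX hfgX => hmin X (hdE.trans hX) hfgX trivial
  have hδE : predim D E = 0 := by
    refine le_antisymm ?_ (isStrong_iff.1 hs E hfgE)
    have h1 := hmin (D ⊔ Submodule.span ℚ (range x₀))
      (sup_le le_sup_left ((Submodule.span_singleton_le_iff_mem _ _).2
        (Submodule.mem_sup_right (Submodule.subset_span ⟨i₀, hi₀⟩))))
      (isFG_sup_left.2 (isFG_span_of_finite D (finite_range x₀))) trivial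
    rw [predim_sup_left] at h1
    exact h1.trans hδ₀
  -- generators `e = (d, s)` of `E` over `D`
  obtain ⟨s, hsE, hEle⟩ := isFG_iff_exists_finset.1 hfgE
  set e : Fin (s.card + 1) → K := Fin.cons d fun i => (s.equivFin.symm i : K) with he
  have he0 : e 0 = d := rfl
  have heE : ∀ i, e i ∈ E := by
    intro i
    refine Fin.cases ?_ (fun j => ?_) i
    · exact hdmem
    · simp only [he, Fin.cons_succ]
      exact hsE (s.equivFin.symm j).2
  have hDe : D ⊔ Submodule.span ℚ (range e) = E := by
    refine le_antisymm (sup_le hDE (Submodule.span_le.2 (by rintro _ ⟨i, rfl⟩; exact heE i))) ?_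
    refine hEle.trans (sup_le le_sup_left ((Submodule.span_mono ?_).trans le_sup_right))
    intro z hz
    refine ⟨Fin.succ (s.equivFin ⟨z, hz⟩), ?_⟩
    simp [he]
  have hδe : predim D (Submodule.span ℚ (range e)) = 0 := by
    rw [← predim_sup_left, hDe]; exact hδE
  -- cross saturation over `ℚτ`
  obtain ⟨e', hγ, hstr', -⟩ := isGammaIsoTw₂_saturation_tau' hsurj hSEAC hker hτ hσ₀ hs hs' hiso hδe
  have hrange : Submodule.span ℚ {τ₁} ⊔ Submodule.span ℚ (range (Fin.append c e)) = E := by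
    rw [ZilberHomogeneity.range_append, Submodule.span_union, ← sup_assoc, ← hDdef, hDe]
  exact ⟨s.card, e, e', he0, hγ, by rw [hrange]; exact hEstrong, hstr'⟩

/-! ### Forth for the whole fields -/

/-- **Forth step between two countable models, both cases** (Kirby 2010, proof of Thm 2.1 /
Bays–Kirby 2018, proof of Thm 6.9; across two fields): a pair of tuples covered by a cross
Γ-isomorphism over `σ₀` with strong spans (`ZilberPrimeModel.Covered₂` with `H₁ = H₂ = ⊤`)
extends by any `d ∈ K`: by `forth_alg` if `d ∈ ecl(c)`, and otherwise by any `d' ∉ ecl(c')` (which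
exists as `K'` has infinite dimension) through the uniqueness of the generic type across two
fields (`GammaField.IsGammaIsoTw₂.append_singleton_of_not_mem`; `ecl(c)` is Γ-closed).
[cite: BaysKirby2013Excellence, Prop. 5 (i)] [cite: Kirby2010QMEC, Thm 2.1 (proof)] -/
theorem forth_top [IsAlgClosed K'] (hsurj : IsSurjectiveOntoUnits K')
    (hSEAC : IsStronglyExpAlgClosed K') (hinf' : ∀ C : Set K', C.Finite → ∃ d, d ∉ ecl C)
    {τ₁ : K} (hker : expKernel K = AddSubgroup.zmultiples τ₁) (hτ : τ₁ ≠ 0) (hexp₁ : exp τ₁ = 1)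
    {τ₂ : K'} (hexp₂ : exp τ₂ = 1)
    {σ₀ : fieldOf (Submodule.span ℚ ({τ₁} : Set K)) ≃+* fieldOf (Submodule.span ℚ ({τ₂} : Set K'))}
    (hσ₀ : IsEBaseIso₂ (Submodule.span ℚ ({τ₁} : Set K)) (Submodule.span ℚ ({τ₂} : Set K')) σ₀)
    {n : ℕ} {x : Fin n → K} {y : Fin n → K'} (h : Covered₂ σ₀ ⊤ ⊤ n x y) (d : K) :
    ∃ d' : K', Covered₂ σ₀ ⊤ ⊤ (n + 1) (Fin.snoc x d) (Fin.snoc y d') := by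
  classical
  obtain ⟨m, c, c', hiso, hs, hs', -, -, hcov⟩ := h
  by_cases hd : d ∈ ecl (range c)
  · -- `d` exponentially algebraic over `c`
    have hdecl : d ∈ ecl (((Submodule.span ℚ {τ₁} ⊔ Submodule.span ℚ (range c) :
        Submodule ℚ K)) : Set K) :=
      ecl_mono (fun z hz => Submodule.mem_sup_right (Submodule.subset_span hz)) hd
    obtain ⟨k, e, e', he0, hγ, hse, hse'⟩ := forth_alg hsurj hSEAC hker hτ hσ₀ hiso hs hs' hdecl
    refine ⟨e' 0, m + (k + 1), Fin.append c e, Fin.append c' e', hγ, hse, hse',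
      fun _ => Submodule.mem_top, fun _ => Submodule.mem_top, ?_⟩
    intro j
    refine Fin.lastCases ?_ (fun j' => ?_) j
    · exact ⟨Fin.natAdd m 0, by simp [he0], by simp⟩
    · obtain ⟨i, hi, hi'⟩ := hcov j'
      exact ⟨Fin.castAdd (k + 1) i, by simp [hi], by simp [hi']⟩
  · -- `d` exponentially transcendental over `c`: a generic partner
    obtain ⟨d', hd'⟩ := hinf' (range c') (finite_range c')
    have hH₁ : IsGammaClosed (Submodule.span ℚ (ecl (range c))) := isGammaClosed_span_ecl_univ _
    have hH₂ : IsGammaClosed (Submodule.span ℚ (ecl (range c'))) := isGammaClosed_span_ecl_univ _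
    have hle₁ : Submodule.span ℚ {τ₁} ⊔ Submodule.span ℚ (range c) ≤ Submodule.span ℚ (ecl (range c)) :=
      sup_le ((Submodule.span_singleton_le_iff_mem _ _).2 (mem_span_ecl_of_exp_eq_one hexp₁ _))
        (Submodule.span_mono (subset_ecl _))
    have hle₂ : Submodule.span ℚ {τ₂} ⊔ Submodule.span ℚ (range c') ≤
        Submodule.span ℚ (ecl (range c')) :=
      sup_le ((Submodule.span_singleton_le_iff_mem _ _).2 (mem_span_ecl_of_exp_eq_one hexp₂ _))
        (Submodule.span_mono (subset_ecl _))
    have hdH : d ∉ Submodule.span ℚ (ecl (range c)) := by rwa [mem_span_ecl_iff]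
    have hd'H : d' ∉ Submodule.span ℚ (ecl (range c')) := by rwa [mem_span_ecl_iff]
    obtain ⟨hγ, hse, hse'⟩ := hiso.append_singleton_of_not_mem hs hs' hH₁ hH₂ hle₁ hle₂ hdH hd'H
    refine ⟨d', m + 1, Fin.append c ![d], Fin.append c' ![d'], hγ, hse, hse',
      fun _ => Submodule.mem_top, fun _ => Submodule.mem_top, ?_⟩
    intro j
    refine Fin.lastCases ?_ (fun j' => ?_) j
    · exact ⟨Fin.natAdd m 0, by simp, by simp⟩
    · obtain ⟨i, hi, hi'⟩ := hcov j'
      exact ⟨Fin.castAdd 1 i, by simp [hi], by simp [hi']⟩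

/-! ### The theorem -/

set_option maxHeartbeats 800000 in
/-- **Countable Zilber fields of infinite dimension are isomorphic** (Kirby 2013 (FPEF),
Cor. 6.10: the countable models of `ECF_{SK,CCP}` are determined by their exponential
transcendence degree — the case of degree `ℵ₀`; Bays–Kirby 2013, §2.1 "there is a unique countable
model `B_{ℵ₀}` of exponential transcendence degree `ℵ₀`"; Zilber 2005, Thm 5.13): two countable
Zilber fields in which no finite set has closure the whole field are isomorphic exponential
fields. Proof: the two-structure back-and-forth through cross Γ-isomorphisms over
`σ₀ : ℚ^{ab}(τ₁) ≅ ℚ^{ab}(τ₂)` with strong spans (`ZilberPrimeModel.Covered₂`, `forth_top` on both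
sides); the limit is a bijection preserving `0, 1, +, ·, exp`.
[cite: Kirby2013FPEF, Cor. 6.10] [cite: BaysKirby2013Excellence, §2.1]
[cite: Zilber2005PseudoExp, Thm 5.13] [cite: BaysKirby2018ANT, Thm 6.9 (proof), Lemma 8.3] -/
theorem exists_equiv [Countable K] [Countable K'] (hK : IsZilberField K) (hK' : IsZilberField K')
    (hinf : ∀ C : Set K, C.Finite → ∃ d, d ∉ ecl C)
    (hinf' : ∀ C : Set K', C.Finite → ∃ d, d ∉ ecl C) :
    Nonempty (ExponentialRingEquiv K K') := by
  classical
  haveI := hK.isAlgClosed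
  haveI := hK'.isAlgClosed
  -- kernel generators and the base isomorphism
  obtain ⟨τ₁, hτ₁, hker₁⟩ := hK.hasStandardKernel
  obtain ⟨τ₂, hτ₂, hker₂⟩ := hK'.hasStandardKernel
  have hexp₁ : exp τ₁ = 1 := exp_eq_one_of_expKernel hker₁
  have hexp₂ : exp τ₂ = 1 := exp_eq_one_of_expKernel hker₂
  have hτ₁0 : τ₁ ≠ 0 := fun h => hτ₁ (by rw [h]; exact isAlgebraic_zero)
  have hτ₂0 : τ₂ ≠ 0 := fun h => hτ₂ (by rw [h]; exact isAlgebraic_zero)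
  obtain ⟨σ₀, hσ₀, -⟩ := exists_isEBaseIso₂_of_expKernel hker₁ hτ₁ hker₂ hτ₂
  have hs₁ : IsStrong (Submodule.span ℚ ({τ₁} : Set K)) :=
    (schanuelProperty_iff_isStrong_span_kernelGenerator hτ₁ hexp₁).1 hK.schanuelProperty
  have hs₂ : IsStrong (Submodule.span ℚ ({τ₂} : Set K')) :=
    (schanuelProperty_iff_isStrong_span_kernelGenerator hτ₂ hexp₂).1 hK'.schanuelProperty
  -- the starting pair: the empty tuples
  have hstart : Covered₂ σ₀ ⊤ ⊤ 0 (Fin.elim0 : Fin 0 → K) (Fin.elim0 : Fin 0 → K') := by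
    have he0 : range (Fin.elim0 : Fin 0 → K) = ∅ := Set.range_eq_empty _
    have he0' : range (Fin.elim0 : Fin 0 → K') = ∅ := Set.range_eq_empty _
    refine ⟨0, Fin.elim0, Fin.elim0, isGammaIsoTw₂_elim0 σ₀, ?_, ?_, fun i => i.elim0,
      fun i => i.elim0, fun j => j.elim0⟩
    · rw [he0, Submodule.span_empty, sup_bot_eq]; exact hs₁
    · rw [he0', Submodule.span_empty, sup_bot_eq]; exact hs₂
  -- the back-and-forth over the whole (countable) fields
  obtain ⟨g', himg, hcov⟩ := exists_map_of_backAndForth₂ (M := K) (N := K')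
    (S := fun n x y => Covered₂ σ₀ ⊤ ⊤ n x y) (C := (univ : Set K)) (C' := (univ : Set K'))
    countable_univ countable_univ hstart (fun n x y h i j => h.apply_eq_iff i j)
    (fun n x y h _ _ d _ => by
      obtain ⟨d', h'⟩ := forth_top hK'.isSurjectiveOntoUnits hK'.isStronglyExpAlgClosed hinf'
        hker₁ hτ₁0 hexp₁ hexp₂ hσ₀ h d
      exact ⟨d', mem_univ _, h'⟩)
    (fun n x y h _ _ d _ => by
      obtain ⟨d₀, hcov⟩ := forth_top hK.isSurjectiveOntoUnits hK.isStronglyExpAlgClosed hinf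
        hker₂ hτ₂0 hexp₂ hexp₁ hσ₀.symm h.symm d
      refine ⟨d₀, mem_univ _, ?_⟩
      have := hcov.symm
      rwa [RingEquiv.symm_symm] at this)
  -- extracting a covering pair for finitely many points
  have hpair : ∀ {k : ℕ} (t : Fin k → K),
      ∃ (m : ℕ) (c : Fin m → K) (c' : Fin m → K'), IsGammaIsoTw₂ σ₀ c c' ∧
        ∀ j, ∃ i, c i = t j ∧ c' i = g' (t j) := by
    intro k t
    obtain ⟨n₀, x, y, hS, -, -, ι, hx, hy⟩ := hcov t (fun _ => mem_univ _)
    obtain ⟨m', c, c', hiso, -, -, -, -, hcv⟩ := hS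
    refine ⟨m', c, c', hiso, fun j => ?_⟩
    obtain ⟨i, hi, hi'⟩ := hcv (ι j)
    exact ⟨i, by rw [hi]; exact congrFun hx j, by rw [hi']; exact congrFun hy j⟩
  -- the map preserves `0, 1, +, ·, exp`
  have hone : g' 1 = 1 := by
    obtain ⟨m', c, c', hiso, hcv⟩ := hpair ![(1 : K)]
    obtain ⟨i, hi, hi'⟩ := hcv 0
    simp only [Matrix.cons_val_zero] at hi hi'
    rw [← hi']
    exact eq_one hiso hi
  have hzero : g' 0 = 0 := by
    obtain ⟨m', c, c', hiso, hcv⟩ := hpair ![(0 : K)]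
    obtain ⟨i, hi, hi'⟩ := hcv 0
    simp only [Matrix.cons_val_zero] at hi hi'
    rw [← hi']
    exact eq_zero hiso hi
  have hadd : ∀ u v : K, g' (u + v) = g' u + g' v := by
    intro u v
    obtain ⟨m', c, c', hiso, hcv⟩ := hpair ![u, v, u + v]
    obtain ⟨i, hi, hi'⟩ := hcv 0
    obtain ⟨j, hj, hj'⟩ := hcv 1
    obtain ⟨k, hk, hk'⟩ := hcv 2
    simp only [Matrix.cons_val_zero, Matrix.cons_val_one, Matrix.head_cons, Matrix.cons_val_two,
      Matrix.tail_cons] at hi hi' hj hj' hk hk'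
    have := add_eq hiso (i := i) (j := j) (k := k) (by rw [hi, hj, hk])
    rw [hi', hj', hk'] at this
    exact this.symm
  have hmul : ∀ u v : K, g' (u * v) = g' u * g' v := by
    intro u v
    obtain ⟨m', c, c', hiso, hcv⟩ := hpair ![u, v, u * v]
    obtain ⟨i, hi, hi'⟩ := hcv 0
    obtain ⟨j, hj, hj'⟩ := hcv 1
    obtain ⟨k, hk, hk'⟩ := hcv 2
    simp only [Matrix.cons_val_zero, Matrix.cons_val_one, Matrix.head_cons, Matrix.cons_val_two,
      Matrix.tail_cons] at hi hi' hj hj' hk hk'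
    have := mul_eq hiso (i := i) (j := j) (k := k) (by rw [hi, hj, hk])
    rw [hi', hj', hk'] at this
    exact this.symm
  have hexpmap : ∀ u : K, g' (exp u) = exp (g' u) := by
    intro u
    obtain ⟨m', c, c', hiso, hcv⟩ := hpair ![u, exp u]
    obtain ⟨i, hi, hi'⟩ := hcv 0
    obtain ⟨k, hk, hk'⟩ := hcv 1
    simp only [Matrix.cons_val_zero, Matrix.cons_val_one] at hi hi' hk hk'
    have := exp_eq hiso (i := i) (k := k) (by rw [hi, hk])
    rw [hi', hk'] at this
    exact this.symm
  let φ : ExponentialRingHom K K' :=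
    { toFun := g'
      map_one' := hone
      map_mul' := hmul
      map_zero' := hzero
      map_add' := hadd
      map_exp' := fun u => by exact hexpmap u }
  have hφ : ∀ z, φ z = g' z := fun _ => rfl
  have hsurjφ : Function.Surjective φ.toRingHom := by
    intro w
    have hw : w ∈ g' '' (univ : Set K) := by rw [himg]; exact mem_univ w
    obtain ⟨z, -, rfl⟩ := hw
    exact ⟨z, rfl⟩
  have hbij : Function.Bijective φ.toRingHom := ⟨φ.toRingHom.injective, hsurjφ⟩
  exact ⟨{ toRingEquiv := RingEquiv.ofBijective φ.toRingHom hbij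
           map_exp' := fun u => by exact hexpmap u }⟩

end ZilberCountableIso

end Literature.NumberTheory.Transcendental

end
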